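import Summits.NavierStokesRegularity.NavierStokesRegularity.Theses.QuarterTurnRdss
import Literature.Analysis.FluidPDE.TypeIAncientMild

/-!
# Birth skeleton (BC3) for the split piece `TwistedCellDecay` — crux `QuarterTurnProfileExists`
# (stmt-NavierStokesRegularity-1100), route `QuarterTurnRdss`, summit NavierStokesRegularity (negative side)

Line `birth` = line **(L) "Liouville in time"** for the ∀-piece of the period-cell split (crux-strategist
seat `cstrat-stmt-NavierStokesRegularity-1100-r1`). The piece: every quarter-turn twisted cell (bounded,
jointly continuous, weakly divergence free, Oseen-mild on the model period `[-1, -c⁻²]`, closing up under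
the twisted zoom) obeys the Type-I SPACE–time bound `‖v(t,x)‖ ≤ C₀/(‖x‖ + √(-t))` on the period. It
holds in BOTH worlds; this line covers the Liouville world, where it holds because the cell is zero:

* `stub_timeTypeI_liouville` (XL, open; the TRANSFER stub): every quarter-turn twisted cell has zero
  initial slice, `v(-1) = 0` — the Liouville theorem for Type-I-IN-TIME (no spatial decay assumed)
  quarter-turn RDSS ancient solutions in the Oseen gauge, in cell form. Solved sibling = KNSS 2009
  Thm 5.3 (axisymmetric ancient mild solutions with `|u| ≤ C/√(-t)` vanish; tree `KNSSThm53*`), whose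
  maximum-principle for `Γ = r u_θ` is exactly what a genuinely 3-D twisted cell lacks (BradshawTsai2017CPDE
  OP 5.2); the other engine is the Chae–Wolf §3 / Pineau–Vicol 2026 compactness-plus-Tsai argument, where
  `2 log c`-periodicity modulo `R` must replace spatial decay. STRONGER than `¬TwistedCellExists` (it also
  kills untwisted cells), so a proof closes the route `refuted:TwistedCellExists` as a by-product — honest:
  on this line the ∀-piece is carried by the negative programme.
* `stub_cell_vanishes_of_datum` (M, provable): a twisted cell with zero initial slice vanishes on the whole
  period — uniqueness of bounded, jointly continuous Oseen-mild solutions from the zero datum (Gronwall on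
  the sup norm through the kernel bound `‖B(v,v)(t)‖_∞ ≤ K√(t-s)‖v‖_∞²`; tree `OseenMildUniqueness.lean`,
  `exists_norm_oseenDuhamel_bounded_le`).

Composition `TwistedCellDecay_of` (kernel-checked): `v ≡ 0` on the period, so `C₀ = 0` works.
The second line (R) "no satellites" (regularity off the origin at the final time) is the file
`no-satellites.lean` of the same seat.

Until `route edit --split QuarterTurnProfileExists` has rendered the piece, the piece is the LOCAL verbatim
copy `TwistedCellDecay` below (same text as children.json); afterwards replace it by
`Summit.NavierStokesRegularity.NavierStokesRegularity.Theses.QuarterTurnRdss.TwistedCellDecay` (`Iff.rfl`).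

Disproof used: none — no `Disproof.lean` / Negative lemma exists for this crux (`ledger crux ls`, 2026-08-17).
-/

noncomputable section

namespace Summit.NavierStokesRegularity.NavierStokesRegularity.Cruxes.TwistedCellDecay.Birth

open MeasureTheory Set Function Filter
open Literature.Analysis.FluidPDE

set_option linter.dupNamespace false

/-! ## The piece (local verbatim copy) and the two statements of the line -/

/-- LOCAL verbatim copy of the split piece `QuarterTurnRdss.TwistedCellDecay` (children.json). -/
def TwistedCellDecay : Prop :=
  ∀ c : ℝ, 1 < c → ∀ R : EuclideanSpace ℝ (Fin 3) ≃ₗᵢ[ℝ] EuclideanSpace ℝ (Fin 3), (∀ x : EuclideanSpace ℝ (Fin 3), (R x) 0 = -(x 1) ∧ (R x) 1 = x 0 ∧ (R x) 2 = x 2) → ∀ v : ℝ → EuclideanSpace ℝ (Fin 3) → EuclideanSpace ℝ (Fin 3), (ContinuousOn (Function.uncurry v) (Set.Icc (-1 : ℝ) (-(c ^ 2)⁻¹) ×ˢ Set.univ) ∧ (∃ M : ℝ, ∀ t ∈ Set.Icc (-1 : ℝ) (-(c ^ 2)⁻¹), ∀ x, ‖v t x‖ ≤ M) ∧ (∀ t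 ∈ Set.Icc (-1 : ℝ) (-(c ^ 2)⁻¹), Literature.Analysis.FluidPDE.IsWeaklyDivFree (v t)) ∧ (∀ s t : ℝ, -1 ≤ s → s < t → t ≤ -(c ^ 2)⁻¹ → ∀ x, v t x = Literature.Analysis.FluidPDE.heatFlow (v s) (t - s) x - Literature.Analysis.FluidPDE.oseenDuhamel 1 s v v t x) ∧ (∀ x, v (-(c ^ 2)⁻¹) x = c • R.symm (v (-1) (c • R x)))) → ∃ C₀ : ℝ, ∀ t ∈ Set.Icc (-1 : ℝ) (-(c ^ 2)⁻¹), ∀ x, ‖v t x‖ ≤ C₀ / (‖x‖ + Real.sqrt (-t))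

/-- Statement of stub 1 (Liouville in time, quarter-turn class, cell form). -/
def TimeTypeILiouville : Prop :=
  ∀ c : ℝ, 1 < c → ∀ R : EuclideanSpace ℝ (Fin 3) ≃ₗᵢ[ℝ] EuclideanSpace ℝ (Fin 3), (∀ x : EuclideanSpace ℝ (Fin 3), (R x) 0 = -(x 1) ∧ (R x) 1 = x 0 ∧ (R x) 2 = x 2) → ∀ v : ℝ → EuclideanSpace ℝ (Fin 3) → EuclideanSpace ℝ (Fin 3), (ContinuousOn (Function.uncurry v) (Set.Icc (-1 : ℝ) (-(c ^ 2)⁻¹) ×ˢ Set.univ) ∧ (∃ M : ℝ, ∀ t ∈ Set.Icc (-1 : ℝ) (-(c ^ 2)⁻¹), ∀ x, ‖v t x‖ ≤ M) ∧ (∀ t ∈ Set.Icc (-1 : ℝ) (-(c ^ 2)⁻¹), Literature.Analysis.FluidPDE.IsWeaklyDivFree (v t)) ∧ (∀ s t : ℝ, -1 ≤ s → s < t → t ≤ -(c ^ 2)⁻¹ → ∀ x, v t x = Literature.Analysis.FluidPDE.heatFlow (v s) (t - s) x - Literature.Analysis.FluidPDE.oseenDuhamel 1 s v v t x) ∧ (∀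 x, v (-(c ^ 2)⁻¹) x = c • R.symm (v (-1) (c • R x)))) → ∀ x, v (-1) x = 0

/-- Statement of stub 2 (zero datum ⇒ zero cell). -/
def CellVanishesOfDatum : Prop :=
  ∀ c : ℝ, 1 < c → ∀ (R : EuclideanSpace ℝ (Fin 3) ≃ₗᵢ[ℝ] EuclideanSpace ℝ (Fin 3)) (v : ℝ → EuclideanSpace ℝ (Fin 3) → EuclideanSpace ℝ (Fin 3)), (ContinuousOn (Function.uncurry v) (Set.Icc (-1 : ℝ) (-(c ^ 2)⁻¹) ×ˢ Set.univ) ∧ (∃ M : ℝ, ∀ t ∈ Set.Icc (-1 : ℝ) (-(c ^ 2)⁻¹), ∀ x, ‖v t x‖ ≤ M) ∧ (∀ t ∈ Set.Icc (-1 : ℝ) (-(c ^ 2)⁻¹), Literature.Analysis.FluidPDE.IsWeaklyDivFree (v t)) ∧ (∀ s t : ℝ, -1 ≤ s → s < t → t ≤ -(c ^ 2)⁻¹ → ∀ x, v t x = Literature.Analysis.FluidPDE.heatFlow (v s) (t - s) x - Literature.Analysis.FluidPDE.oseenDuhamel 1 s v v t x) ∧ (∀ x, v (-(c ^ 2)⁻¹)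 x = c • R.symm (v (-1) (c • R x)))) → (∀ x, v (-1) x = 0) → ∀ t ∈ Set.Icc (-1 : ℝ) (-(c ^ 2)⁻¹), ∀ x, v t x = 0

namespace Registered

/-- Alias keyed by the registered stub name. -/
abbrev stub_timeTypeI_liouville : Prop := TimeTypeILiouville
/-- Alias keyed by the registered stub name. -/
abbrev stub_cell_vanishes_of_datum : Prop := CellVanishesOfDatum

end Registered

/-! ## Registered stubs (the ONLY `sorry`s of the file; literal signatures) -/

/-- **Stub 1 (XL, open — transfer of KNSS 2009 Thm 5.3 to the quarter-turn class): Liouville in time.**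
For `c > 1`, the quarter-turn `R` and a twisted cell `v` on `[-1, -c⁻²]` (jointly continuous, bounded,
weakly divergence free, Oseen-mild between all pairs of model times, `v(-c⁻²,x) = c R⁻¹ v(-1,cRx)`), the
initial slice vanishes: `v(-1) = 0`. Equivalently (concatenation): Type-I-IN-TIME quarter-turn RDSS ancient
Oseen-mild solutions are zero. Why it might fail: it is the Liouville conjecture of the route's ¬-side
WITHOUT the spatial-decay hypothesis (Tsai2018 Conj. 8.8–8.9 flavour); the only max-principle engine
(KNSS Thm 5.3, `Γ = r u_θ`) is axisymmetric, and the compactness engines (ChaeWolf2017 §3, PineauVicol2026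
Thm 1.7) reach only `c` near 1 or extreme twist speeds.
[sources: KNSS2009 Thm 5.3; SereginSverak2009; ChaeWolf2017RemovingDSS Thm 1.3, §3; PineauVicol2026 Thms 1.6–1.7; BradshawTsai2017CPDE OP 5.1–5.2; Tsai2018 Conj. 8.8–8.9] -/
theorem stub_timeTypeI_liouville :
    ∀ c : ℝ, 1 < c → ∀ R : EuclideanSpace ℝ (Fin 3) ≃ₗᵢ[ℝ] EuclideanSpace ℝ (Fin 3), (∀ x : EuclideanSpace ℝ (Fin 3), (R x) 0 = -(x 1) ∧ (R x) 1 = x 0 ∧ (R x) 2 = x 2) → ∀ v : ℝ → EuclideanSpace ℝ (Fin 3) → EuclideanSpace ℝ (Fin 3), (ContinuousOn (Function.uncurry v) (Set.Icc (-1 : ℝ) (-(c ^ 2)⁻¹) ×ˢ Set.univ) ∧ (∃ M : ℝ, ∀ t ∈ Set.Icc (-1 : ℝ) (-(c ^ 2)⁻¹), ∀ x, ‖v t x‖ ≤ M) ∧ (∀ t ∈ Set.Icc (-1 : ℝ) (-(c ^ 2)⁻¹), Literature.Analysis.FluidPDE.IsWeaklyDivFree (v t)) ∧ (∀ s t : ℝ,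 -1 ≤ s → s < t → t ≤ -(c ^ 2)⁻¹ → ∀ x, v t x = Literature.Analysis.FluidPDE.heatFlow (v s) (t - s) x - Literature.Analysis.FluidPDE.oseenDuhamel 1 s v v t x) ∧ (∀ x, v (-(c ^ 2)⁻¹) x = c • R.symm (v (-1) (c • R x)))) → ∀ x, v (-1) x = 0 := by
  sorry

/-- **Stub 2 (M, provable): a twisted cell with zero initial slice is zero on the whole period.**
Uniqueness of bounded, jointly continuous solutions of the Oseen integral equation
`v(t) = e^{(t+1)Δ}v(-1) − B¹_{-1}(v,v)(t)` from the zero datum: `‖v(t)‖_∞ ≤ K√(t+1)·sup‖v‖_∞·‖v(·)‖_∞`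
and Gronwall / a continuity argument on `[-1, -c⁻²]`.
[sources: KNSS2009 §4 (bilinear estimate (4.3)); LemarieRieusset2016 Thm 6.1; tree OseenMildUniqueness.lean, exists_norm_oseenDuhamel_bounded_le] -/
theorem stub_cell_vanishes_of_datum :
    ∀ c : ℝ, 1 < c → ∀ (R : EuclideanSpace ℝ (Fin 3) ≃ₗᵢ[ℝ] EuclideanSpace ℝ (Fin 3)) (v : ℝ → EuclideanSpace ℝ (Fin 3) → EuclideanSpace ℝ (Fin 3)), (ContinuousOn (Function.uncurry v) (Set.Icc (-1 : ℝ) (-(c ^ 2)⁻¹) ×ˢ Set.univ) ∧ (∃ M : ℝ, ∀ t ∈ Set.Icc (-1 : ℝ) (-(c ^ 2)⁻¹), ∀ x, ‖v t x‖ ≤ M) ∧ (∀ t ∈ Set.Icc (-1 : ℝ) (-(c ^ 2)⁻¹), Literature.Analysis.FluidPDE.IsWeaklyDivFree (v t)) ∧ (∀ s t : ℝ, -1 ≤ s → s < t → t ≤ -(c ^ 2)⁻¹ → ∀ x, v t x = Literature.Analysis.FluidPDE.heatFlow (v s) (t - s) x - Literature.Analysis.FluidPDE.oseenDuhamel 1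 s v v t x) ∧ (∀ x, v (-(c ^ 2)⁻¹) x = c • R.symm (v (-1) (c • R x)))) → (∀ x, v (-1) x = 0) → ∀ t ∈ Set.Icc (-1 : ℝ) (-(c ^ 2)⁻¹), ∀ x, v t x = 0 := by
  sorry

/-! ## Composition (kernel-checked; no `sorry` in the closure of `TwistedCellDecay_of`) -/

/-- **Composition: the two stubs imply the piece `TwistedCellDecay`** (with `C₀ = 0`). -/
theorem TwistedCellDecay_of (h₁ : Registered.stub_timeTypeI_liouville)
    (h₂ : Registered.stub_cell_vanishes_of_datum) : TwistedCellDecay := by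
  dsimp only [Registered.stub_timeTypeI_liouville, TimeTypeILiouville,
    Registered.stub_cell_vanishes_of_datum, CellVanishesOfDatum] at h₁ h₂
  intro c hc R hR v hcell
  have h0 : ∀ x, v (-1) x = 0 := h₁ c hc R hR v hcell
  have hall : ∀ t ∈ Set.Icc (-1 : ℝ) (-(c ^ 2)⁻¹), ∀ x, v t x = 0 := h₂ c hc R v hcell h0
  refine ⟨0, fun t ht x => ?_⟩
  rw [hall t ht x, norm_zero, zero_div]

/-! ## Wiring check -/

/-- The sorried stubs, with their LITERAL signatures, feed `TwistedCellDecay_of` exactly as stated. -/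
theorem twistedCellDecay_of_stubs : TwistedCellDecay :=
  TwistedCellDecay_of stub_timeTypeI_liouville stub_cell_vanishes_of_datum

end Summit.NavierStokesRegularity.NavierStokesRegularity.Cruxes.TwistedCellDecay.Birth

end
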